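/-
Copyright: the b2b-balaban T⁴-continuum CRUX team, row NE7b OWNER lineage `t4-ne7b-p1` (gen 142). Project licence.
-/
import Summits.QuantumFields.BalabanUV.T4Continuum.Spine.NE7b.SupKernelSchurQuadrilinear

/-!
# THE OPERATOR LETTER OF A QUINTILINEAR KERNEL FROM TWO SLOT LETTERS (Schur at order 5; SCOPING (d14)(2)(vi), first order-five file).
# (481)∕(530) read the operator norm of a `3`-∕`4`-linear map on `ℝ^ι` off two fixed-slot letters by a weighted Cauchy–Schwarz; the same device
# at order five — the LAST order of the kernel-letter class ((431)∕(433): at `d = 4` the remainder is order `≥ 5`): for a continuous `5`-linear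
# map `P` with entries `P_{xyzts} = P[e_x,e_y,e_z,e_t,e_s]`, the slot-4 letter `Σ_{x,y,z,s}|P_{xyzts}| ≤ L₄` (all `t`) and the slot-5 letter
# `Σ_{x,y,z,t}|P_{xyzts}| ≤ L₅` (all `s`) give
#   `|P[φ,h,k,m,v]| ≤ √(L₄L₅)·‖φ‖·‖h‖·‖k‖·‖m‖·‖v‖`,   hence   `‖P‖ ≤ √(L₄L₅)`
# (the first three slots by `|φ_x| ≤ ‖φ‖` etc.; the last two by (481)'s weighted Cauchy–Schwarz with `S_{ts} = Σ_{x,y,z}|P_{xyzts}|`).  This is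
# how the operator letter `κ₅⁺` of the next step will be READ OFF the five slot letters of the order-5 output majorant (successor) (row NE7b,
# node U5c; (481) `weighted_cauchy_schwarz`, (530) `quadrilinear_expand` BY NAME; [folklore])

Cell `pub-balaban`, sub-cell `t4`, spine estimate NE7b (`T4WeightBudget.RelWeightBound`; the cell's OWN estimate — NOT PRINTED in
[Bałaban 1983–89], NOT PROVED).  Crux-route work under `Spine/NE7b/` by the row OWNER (`t4-ne7b-p1` gen 142, file (536)) under FREEZE
(0)'s crux-prover clause; NOTHING of Bałaban's is named as a Lean object, valued or asserted; no `T4Continuum/Support` leaf typed; no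
`def`, no notation; zero `sorry`.  Imports (BY NAME): the OWNER's (530) `…SupKernelSchurQuadrilinear` (`quadrilinear_expand`; through it (481)
`weighted_cauchy_schwarz`).

WHAT IS PROVED ([folklore]): §1 `quintilinear_kernel_sum_le`; §2 `expand_first_slot_five`, `quintilinear_expand`, THE END
**`opNorm_le_of_slot_letters_five`**; §3 toy.

HONEST (what this is NOT).  A finite-dimensional inequality; its application to `∂⁵W` needs the whole order-five block (cumulant form, entry
majorant, five slot letters, `C⁵` packaging — NOT typed; memo SCOPING-d14); scalar skeleton ((A3), NC-NE7b-α UNRULED); nothing of Bałaban's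
asserted.  BY-NAME EFFECT ON THE WALL: NONE.  NE7b NOT PRINTED ∕ NOT PROVED; spine PROVED 0∕9; rung (B)+1 — the programme's measures remain
FINITE-torus statements; NOT the mass gap, NOT Clay.  HONEST DEPENDENCY: continuum YM on T⁴ ⇐ BetaPertH ∧ nine spine estimates (0∕9 proved);
BetaPertH ⇐ (D1) ∧ (D4) ∧ CAP+tail; G-an2-4 gates asym, D1 and NE2∕3∕4.
-/

set_option autoImplicit false
set_option maxSynthPendingDepth 4

noncomputable section

namespace Summit.QuantumFields.BalabanUV.T4Continuum.NE7b.SupKernelSchurQuintilinear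

open Real Finset
open scoped BigOperators
open SupKernelSchurTrilinear (weighted_cauchy_schwarz)
open SupKernelSchurQuadrilinear (quadrilinear_expand)

variable {ι : Type} [Fintype ι]

/-! ## §1. Scalar quintilinear kernels -/

/-- **A quintilinear kernel sum is bounded by two slot letters**: `Σ_{x,y,z,s}|P_{xyzts}| ≤ L₄` (all `t`), `Σ_{x,y,z,t}|P_{xyzts}| ≤ L₅` (all `s`)
give `|Σ_{x,y,z,t,s}φ_xh_yk_zm_tv_sP_{xyzts}| ≤ √(L₄L₅)·‖φ‖·‖h‖·‖k‖·‖m‖·‖v‖`. [folklore] -/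
theorem quintilinear_kernel_sum_le (P₅ : ι → ι → ι → ι → ι → ℝ) {L₄ L₅ : ℝ} (hs4 : ∀ t, ∑ x, ∑ y, ∑ z, ∑ s, |P₅ x y z t s| ≤ L₄)
    (hs5 : ∀ s, ∑ x, ∑ y, ∑ z, ∑ t, |P₅ x y z t s| ≤ L₅) (φ h k m v : EuclideanSpace ℝ ι) :
    |∑ x, ∑ y, ∑ z, ∑ t, ∑ s, φ x * h y * k z * m t * v s * P₅ x y z t s| ≤ Real.sqrt (L₄ * L₅) * ‖φ‖ * ‖h‖ * ‖k‖ * ‖m‖ * ‖v‖ := by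
  have hφ : ∀ x, |φ x| ≤ ‖φ‖ := fun x => by rw [← Real.norm_eq_abs]; exact PiLp.norm_apply_le φ x
  have hh : ∀ y, |h y| ≤ ‖h‖ := fun y => by rw [← Real.norm_eq_abs]; exact PiLp.norm_apply_le h y
  have hk : ∀ z, |k z| ≤ ‖k‖ := fun z => by rw [← Real.norm_eq_abs]; exact PiLp.norm_apply_le k z
  -- the triangle inequality and the first three slots
  have h1 : |∑ x, ∑ y, ∑ z, ∑ t, ∑ s, φ x * h y * k z * m t * v s * P₅ x y z t s| ≤
      ∑ x, ∑ y, ∑ z, ∑ t, ∑ s, ‖φ‖ * ‖h‖ * ‖k‖ * (|P₅ x y z t s| * |m t| * |v s|) := by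
    refine (Finset.abs_sum_le_sum_abs _ _).trans (Finset.sum_le_sum fun x _ => ?_)
    refine (Finset.abs_sum_le_sum_abs _ _).trans (Finset.sum_le_sum fun y _ => ?_)
    refine (Finset.abs_sum_le_sum_abs _ _).trans (Finset.sum_le_sum fun z _ => ?_)
    refine (Finset.abs_sum_le_sum_abs _ _).trans (Finset.sum_le_sum fun t _ => ?_)
    refine (Finset.abs_sum_le_sum_abs _ _).trans (Finset.sum_le_sum fun s _ => ?_)
    rw [abs_mul, abs_mul, abs_mul, abs_mul, abs_mul]
    have hnn : 0 ≤ |P₅ x y z t s| * |m t| * |v s| := by positivity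
    calc |φ x| * |h y| * |k z| * |m t| * |v s| * |P₅ x y z t s| = |φ x| * |h y| * |k z| * (|P₅ x y z t s| * |m t| * |v s|) := by ring
      _ ≤ ‖φ‖ * ‖h‖ * ‖k‖ * (|P₅ x y z t s| * |m t| * |v s|) :=
          mul_le_mul_of_nonneg_right (mul_le_mul (mul_le_mul (hφ x) (hh y) (abs_nonneg _) (norm_nonneg _)) (hk z) (abs_nonneg _)
            (mul_nonneg (norm_nonneg _) (norm_nonneg _))) hnn
  -- regroup: the weight `S_{ts} = Σ_xΣ_yΣ_z|P_{xyzts}|`; reorder `(x,y,z,t,s) → (t,s,x,y,z)`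
  have h2 : ∑ x, ∑ y, ∑ z, ∑ t, ∑ s, ‖φ‖ * ‖h‖ * ‖k‖ * (|P₅ x y z t s| * |m t| * |v s|) =
      ‖φ‖ * ‖h‖ * ‖k‖ * ∑ t, ∑ s, (∑ x, ∑ y, ∑ z, |P₅ x y z t s|) * |m t| * |v s| := by
    have e1 : ∀ t s, (∑ x, ∑ y, ∑ z, |P₅ x y z t s|) * |m t| * |v s| = ∑ x, ∑ y, ∑ z, |P₅ x y z t s| * |m t| * |v s| := fun t s => by
      rw [Finset.sum_mul, Finset.sum_mul]
      refine Finset.sum_congr rfl fun x _ => ?_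
      rw [Finset.sum_mul, Finset.sum_mul]
      refine Finset.sum_congr rfl fun y _ => ?_
      rw [Finset.sum_mul, Finset.sum_mul]
    simp_rw [e1]
    simp only [Finset.mul_sum]
    -- move `t` and `s` to the front, one transposition at a time
    calc ∑ x, ∑ y, ∑ z, ∑ t, ∑ s, ‖φ‖ * ‖h‖ * ‖k‖ * (|P₅ x y z t s| * |m t| * |v s|)
        = ∑ x, ∑ y, ∑ t, ∑ z, ∑ s, ‖φ‖ * ‖h‖ * ‖k‖ * (|P₅ x y z t s| * |m t| * |v s|) :=
          Finset.sum_congr rfl fun x _ => Finset.sum_congr rfl fun y _ => Finset.sum_comm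
      _ = ∑ x, ∑ t, ∑ y, ∑ z, ∑ s, ‖φ‖ * ‖h‖ * ‖k‖ * (|P₅ x y z t s| * |m t| * |v s|) := Finset.sum_congr rfl fun x _ => Finset.sum_comm
      _ = ∑ t, ∑ x, ∑ y, ∑ z, ∑ s, ‖φ‖ * ‖h‖ * ‖k‖ * (|P₅ x y z t s| * |m t| * |v s|) := Finset.sum_comm
      _ = ∑ t, ∑ x, ∑ y, ∑ s, ∑ z, ‖φ‖ * ‖h‖ * ‖k‖ * (|P₅ x y z t s| * |m t| * |v s|) :=
          Finset.sum_congr rfl fun t _ => Finset.sum_congr rfl fun x _ => Finset.sum_congr rfl fun y _ => Finset.sum_comm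
      _ = ∑ t, ∑ x, ∑ s, ∑ y, ∑ z, ‖φ‖ * ‖h‖ * ‖k‖ * (|P₅ x y z t s| * |m t| * |v s|) :=
          Finset.sum_congr rfl fun t _ => Finset.sum_congr rfl fun x _ => Finset.sum_comm
      _ = ∑ t, ∑ s, ∑ x, ∑ y, ∑ z, ‖φ‖ * ‖h‖ * ‖k‖ * (|P₅ x y z t s| * |m t| * |v s|) := Finset.sum_congr rfl fun t _ => Finset.sum_comm
  have hrow : ∀ t, ∑ s, ∑ x, ∑ y, ∑ z, |P₅ x y z t s| ≤ L₄ := fun t => by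
    calc ∑ s, ∑ x, ∑ y, ∑ z, |P₅ x y z t s| = ∑ x, ∑ s, ∑ y, ∑ z, |P₅ x y z t s| := Finset.sum_comm
      _ = ∑ x, ∑ y, ∑ s, ∑ z, |P₅ x y z t s| := Finset.sum_congr rfl fun x _ => Finset.sum_comm
      _ = ∑ x, ∑ y, ∑ z, ∑ s, |P₅ x y z t s| := Finset.sum_congr rfl fun x _ => Finset.sum_congr rfl fun y _ => Finset.sum_comm
      _ ≤ L₄ := hs4 t
  have hcol : ∀ s, ∑ t, ∑ x, ∑ y, ∑ z, |P₅ x y z t s| ≤ L₅ := fun s => by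
    calc ∑ t, ∑ x, ∑ y, ∑ z, |P₅ x y z t s| = ∑ x, ∑ t, ∑ y, ∑ z, |P₅ x y z t s| := Finset.sum_comm
      _ = ∑ x, ∑ y, ∑ t, ∑ z, |P₅ x y z t s| := Finset.sum_congr rfl fun x _ => Finset.sum_comm
      _ = ∑ x, ∑ y, ∑ z, ∑ t, |P₅ x y z t s| := Finset.sum_congr rfl fun x _ => Finset.sum_congr rfl fun y _ => Finset.sum_comm
      _ ≤ L₅ := hs5 s
  have h3 := weighted_cauchy_schwarz (fun t s => ∑ x, ∑ y, ∑ z, |P₅ x y z t s|)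
    (fun t s => Finset.sum_nonneg fun x _ => Finset.sum_nonneg fun y _ => Finset.sum_nonneg fun z _ => abs_nonneg _) hrow hcol m v
  rw [h2] at h1
  calc |∑ x, ∑ y, ∑ z, ∑ t, ∑ s, φ x * h y * k z * m t * v s * P₅ x y z t s|
      ≤ ‖φ‖ * ‖h‖ * ‖k‖ * ∑ t, ∑ s, (∑ x, ∑ y, ∑ z, |P₅ x y z t s|) * |m t| * |v s| := h1
    _ ≤ ‖φ‖ * ‖h‖ * ‖k‖ * (Real.sqrt (L₄ * L₅) * ‖m‖ * ‖v‖) :=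
        mul_le_mul_of_nonneg_left h3 (mul_nonneg (mul_nonneg (norm_nonneg _) (norm_nonneg _)) (norm_nonneg _))
    _ = Real.sqrt (L₄ * L₅) * ‖φ‖ * ‖h‖ * ‖k‖ * ‖m‖ * ‖v‖ := by ring

/-! ## §2. THE END: the operator letter of a quintilinear map from its slot letters -/

section Operator

variable [DecidableEq ι]

set_option synthInstance.maxHeartbeats 200000 in
/-- **Expansion of the first slot of a `5`-linear form**: `P w h k m v = Σ_u w_u · P e_u h k m v`. [folklore] -/
theorem expand_first_slot_five
    (P : EuclideanSpace ℝ ι →L[ℝ] EuclideanSpace ℝ ι →L[ℝ] EuclideanSpace ℝ ι →L[ℝ] EuclideanSpace ℝ ι →L[ℝ] EuclideanSpace ℝ ι →L[ℝ] ℝ)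
    (w h k m v : EuclideanSpace ℝ ι) : P w h k m v = ∑ u, w u * P (EuclideanSpace.single u (1 : ℝ)) h k m v := by
  have hw : w = ∑ u, w u • EuclideanSpace.single u (1 : ℝ) := by
    have e := (EuclideanSpace.basisFun ι ℝ).sum_repr w
    simp only [EuclideanSpace.basisFun_repr, EuclideanSpace.basisFun_apply] at e
    exact e.symm
  conv_lhs => rw [hw]
  simp

/-- **The full coordinate expansion of a quintilinear map**: `P[φ,h,k,m,v] = Σ_xΣ_yΣ_zΣ_tΣ_s φ_x·h_y·k_z·m_t·v_s·P[e_x,e_y,e_z,e_t,e_s]`. [folklore] -/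
theorem quintilinear_expand
    (P : EuclideanSpace ℝ ι →L[ℝ] EuclideanSpace ℝ ι →L[ℝ] EuclideanSpace ℝ ι →L[ℝ] EuclideanSpace ℝ ι →L[ℝ] EuclideanSpace ℝ ι →L[ℝ] ℝ)
    (φ h k m v : EuclideanSpace ℝ ι) :
    P φ h k m v = ∑ x, ∑ y, ∑ z, ∑ t, ∑ s, φ x * h y * k z * m t * v s * P (EuclideanSpace.single x (1 : ℝ)) (EuclideanSpace.single y (1 : ℝ))
      (EuclideanSpace.single z (1 : ℝ)) (EuclideanSpace.single t (1 : ℝ)) (EuclideanSpace.single s (1 : ℝ)) := by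
  rw [expand_first_slot_five P φ h k m v]
  refine Finset.sum_congr rfl fun x _ => ?_
  rw [quadrilinear_expand (P (EuclideanSpace.single x (1 : ℝ))) h k m v, Finset.mul_sum]
  refine Finset.sum_congr rfl fun y _ => ?_
  rw [Finset.mul_sum]
  refine Finset.sum_congr rfl fun z _ => ?_
  rw [Finset.mul_sum]
  refine Finset.sum_congr rfl fun t _ => ?_
  rw [Finset.mul_sum]
  exact Finset.sum_congr rfl fun s _ => by ring

/-- **THE END — SCHUR AT ORDER 5**: a continuous quintilinear map on `ℝ^ι` whose entries have the slot-4 letter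
`Σ_{x,y,z,s}|P[e_x,e_y,e_z,e_t,e_s]| ≤ L₄` and the slot-5 letter `Σ_{x,y,z,t}|P[e_x,e_y,e_z,e_t,e_s]| ≤ L₅` has operator norm `‖P‖ ≤ √(L₄L₅)`.
[folklore] -/
theorem opNorm_le_of_slot_letters_five
    (P : EuclideanSpace ℝ ι →L[ℝ] EuclideanSpace ℝ ι →L[ℝ] EuclideanSpace ℝ ι →L[ℝ] EuclideanSpace ℝ ι →L[ℝ] EuclideanSpace ℝ ι →L[ℝ] ℝ)
    {L₄ L₅ : ℝ}
    (hs4 : ∀ t, ∑ x, ∑ y, ∑ z, ∑ s, |P (EuclideanSpace.single x (1 : ℝ)) (EuclideanSpace.single y (1 : ℝ)) (EuclideanSpace.single z (1 : ℝ))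
      (EuclideanSpace.single t (1 : ℝ)) (EuclideanSpace.single s (1 : ℝ))| ≤ L₄)
    (hs5 : ∀ s, ∑ x, ∑ y, ∑ z, ∑ t, |P (EuclideanSpace.single x (1 : ℝ)) (EuclideanSpace.single y (1 : ℝ)) (EuclideanSpace.single z (1 : ℝ))
      (EuclideanSpace.single t (1 : ℝ)) (EuclideanSpace.single s (1 : ℝ))| ≤ L₅) :
    ‖P‖ ≤ Real.sqrt (L₄ * L₅) := by
  have hC : 0 ≤ Real.sqrt (L₄ * L₅) := Real.sqrt_nonneg _
  refine ContinuousLinearMap.opNorm_le_bound _ hC fun φ => ?_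
  refine ContinuousLinearMap.opNorm_le_bound _ (mul_nonneg hC (norm_nonneg _)) fun h => ?_
  refine ContinuousLinearMap.opNorm_le_bound _ (mul_nonneg (mul_nonneg hC (norm_nonneg _)) (norm_nonneg _)) fun k => ?_
  refine ContinuousLinearMap.opNorm_le_bound _ (mul_nonneg (mul_nonneg (mul_nonneg hC (norm_nonneg _)) (norm_nonneg _)) (norm_nonneg _))
    fun m => ?_
  refine ContinuousLinearMap.opNorm_le_bound _
    (mul_nonneg (mul_nonneg (mul_nonneg (mul_nonneg hC (norm_nonneg _)) (norm_nonneg _)) (norm_nonneg _)) (norm_nonneg _)) fun v => ?_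
  rw [Real.norm_eq_abs, quintilinear_expand P φ h k m v]
  exact quintilinear_kernel_sum_le (fun x y z t s => P (EuclideanSpace.single x (1 : ℝ)) (EuclideanSpace.single y (1 : ℝ))
    (EuclideanSpace.single z (1 : ℝ)) (EuclideanSpace.single t (1 : ℝ)) (EuclideanSpace.single s (1 : ℝ))) hs4 hs5 φ h k m v

end Operator

/-! ## §3. Toy -/

/-- Toy (§1 in numbers, all letters `1`): `√(1·1)·1·1·1·1·1 = 1`. -/
example : Real.sqrt (1 * 1) * 1 * 1 * 1 * 1 * 1 = (1 : ℝ) := by simp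

end Summit.QuantumFields.BalabanUV.T4Continuum.NE7b.SupKernelSchurQuintilinear

end
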